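import Literature.NumberTheory.EllipticCurves.HuShuYin2019.SylvesterThreePart
import HarnessLib

/-!
# `2`-torsion of `y² = x³ + b` over an arbitrary field: `E(F)[2] = 0` unless `−b` is a cube in `F`

The algebraic half of the route's «NO `2`-TORSION OVER THE TOWER» input (memo two §57.3: for the
cube-sum curves `E_n : y² = x³ − 432 n²` and a field `F ∌ ∛(2n²)`, `E_n(F)[2] = 0`; the
class-field-theory half — `∛(4p) ∉ H_{9pn}` — is not treated here): for a field `F` with `2 ≠ 0`
and `b ∈ F`,

* `JZero.eq_zero_of_two_smul_eq_zero` — if `x³ + b` has no root in `F`, every `F`-rational point `P`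
  of `⟨0, 0, 0, 0, b⟩` with `2 • P = 0` is `0` (Silverman–Tate, Thm. 2.1(a): the points of order two
  of `y² = f(x)` are the `(α, 0)` with `f(α) = 0`);
* `JZero.two_smul_eq_zero_iff` — conversely `(α, 0)` has order `2`: `2 • P = 0 ↔ P = 0 ∨ y(P) = 0`;
* `HuShuYin2019.cubeSumCurve_eq_zero_of_two_smul_eq_zero` — for `E_n = ⟨0, 0, 0, 0, −432 n²⟩` over
  `F ⊇ ℚ`: if `2 n²` is not a cube in `F` then `E_n(F)[2] = 0` (`432 n² = 6³ · 2n²`).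

Everything is proved; no new definitions.

## References

* J. H. Silverman, J. Tate, *Rational Points on Elliptic Curves*, 2nd ed. (2015), §2.1, Thm. 2.1(a).
  [SilvermanTate2015]
* J. H. Silverman, *The Arithmetic of Elliptic Curves*, 2nd ed. (2009), III.2.3. [SilvermanAEC2009]
-/

noncomputable section

open scoped Classical

namespace Literature.NumberTheory.EllipticCurves

open WeierstrassCurve

namespace JZero

variable {F : Type*} [Field F]

/-- **`2 • P = 0 ↔ P = 0 ∨ y(P) = 0` on `y² = x³ + b`** over a field with `2 ≠ 0`: `2P = 0` iff
`P = −P`, and `−(x, y) = (x, −y)` on a model with `a₁ = a₃ = 0`. Silverman–Tate, Thm. 2.1(a).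
[cite: SilvermanTate2015, §2.1, Thm. 2.1(a)] -/
theorem two_smul_eq_zero_iff (h2 : (2 : F) ≠ 0) {b : F}
    (P : (⟨0, 0, 0, 0, b⟩ : WeierstrassCurve F).toAffine.Point) :
    2 • P = 0 ↔ P = 0 ∨ ∃ (x : F) (h : (⟨0, 0, 0, 0, b⟩ : WeierstrassCurve F).toAffine.Nonsingular x 0),
      P = Affine.Point.some x 0 h := by
  rw [two_nsmul, add_eq_zero_iff_eq_neg]
  rcases P with _ | ⟨x, y, h⟩
  · exact ⟨fun _ ↦ Or.inl rfl, fun _ ↦ neg_zero.symm⟩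
  · rw [Affine.Point.neg_some, Affine.Point.some.injEq]
    constructor
    · rintro ⟨-, hy⟩
      have e : y = -y - 0 * x - 0 := hy
      have hy0 : y = 0 := by
        have h2y : (2 : F) * y = 0 := by linear_combination e
        rcases mul_eq_zero.mp h2y with h' | h'
        · exact absurd h' h2
        · exact h'
      subst hy0
      exact Or.inr ⟨x, h, rfl⟩
    · rintro (h0 | ⟨x', h', e⟩)
      · exact absurd h0 (by simp)
      · rw [Affine.Point.some.injEq] at e
        obtain ⟨rfl, rfl⟩ := e
        refine ⟨rfl, ?_⟩
        change (0 : F) = -0 - 0 * x - 0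
        ring

/-- **`E(F)[2] = 0` when `x³ + b` has no root in `F`** (`E : y² = x³ + b`, `2 ≠ 0` in `F`): a point of
order `2` is `(α, 0)` with `α³ + b = 0`. Silverman–Tate, Thm. 2.1(a).
[cite: SilvermanTate2015, §2.1, Thm. 2.1(a)] -/
theorem eq_zero_of_two_smul_eq_zero (h2 : (2 : F) ≠ 0) {b : F} (hb : ∀ x : F, x ^ 3 + b ≠ 0)
    (P : (⟨0, 0, 0, 0, b⟩ : WeierstrassCurve F).toAffine.Point) (hP : 2 • P = 0) : P = 0 := by
  rcases (two_smul_eq_zero_iff h2 P).mp hP with h0 | ⟨x, h, -⟩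
  · exact h0
  · exfalso
    have heq := (Affine.equation_iff x 0).mp h.1
    apply hb x
    change (0 : F) ^ 2 + 0 * x * 0 + 0 * 0 = x ^ 3 + 0 * x ^ 2 + 0 * x + b at heq
    linear_combination -heq

/-- **No `F`-rational `2`-torsion forces injectivity of `2^k`… (the basic case `k = 1`)**: under the
same hypothesis, `P ↦ 2 • P` is injective on `E(F)`. [cite: SilvermanTate2015, §2.1, Thm. 2.1(a)] -/
theorem two_smul_injective (h2 : (2 : F) ≠ 0) {b : F} (hb : ∀ x : F, x ^ 3 + b ≠ 0) :
    Function.Injective fun P : (⟨0, 0, 0, 0, b⟩ : WeierstrassCurve F).toAffine.Point ↦ 2 • P := by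
  intro P Q hPQ
  have h : 2 • (P - Q) = 0 := by
    change 2 • P = 2 • Q at hPQ
    rw [nsmul_sub, hPQ, sub_self]
  exact sub_eq_zero.mp (eq_zero_of_two_smul_eq_zero h2 hb _ h)

/-- **No `2^k`-torsion either**: under the same hypothesis, `2 ^ k • P = 0 → P = 0`.
[cite: SilvermanTate2015, §2.1, Thm. 2.1(a)] -/
theorem eq_zero_of_two_pow_smul_eq_zero (h2 : (2 : F) ≠ 0) {b : F} (hb : ∀ x : F, x ^ 3 + b ≠ 0)
    (k : ℕ) (P : (⟨0, 0, 0, 0, b⟩ : WeierstrassCurve F).toAffine.Point) (hP : 2 ^ k • P = 0) :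
    P = 0 := by
  induction k generalizing P with
  | zero => simpa using hP
  | succ k ih =>
    apply ih
    apply eq_zero_of_two_smul_eq_zero h2 hb
    rw [← mul_nsmul', ← pow_succ']
    exact hP

end JZero

namespace HuShuYin2019

/-- **`E_n(F)[2] = 0` for the cube-sum curve `E_n : y² = x³ − 432 n²` over a field `F ⊇ ℚ` in which
`2 n²` is not a cube** (`432 n² = 6³ · (2 n²)`, so a root of `x³ − 432 n²` is `6 ∛(2n²)`); e.g.
`F = ℚ(ω)` or a ring class field of `ℚ(ω)` of conductor prime to `2` when `n = p` is a prime
`≠ 2, 3` (memo two §57.3; the field-theoretic input `∛(2p²) ∉ F` is the caller's).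
[cite: SilvermanTate2015, §2.1, Thm. 2.1(a)] [cite: HuShuYin2019, §2] -/
theorem cubeSumCurve_eq_zero_of_two_smul_eq_zero {F : Type*} [Field F] [CharZero F] (n : ℚ)
    (hF : ∀ t : F, t ^ 3 ≠ 2 * (n : F) ^ 2)
    (P : ((cubeSumCurve n).baseChange F).toAffine.Point) (hP : 2 • P = 0) : P = 0 := by
  have hmap : (cubeSumCurve n).baseChange F = ⟨0, 0, 0, 0, -432 * (n : F) ^ 2⟩ := by
    change (⟨0, 0, 0, 0, -432 * n ^ 2⟩ : WeierstrassCurve ℚ).map (algebraMap ℚ F) = _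
    ext <;> simp [WeierstrassCurve.map]
  have hb : ∀ x : F, x ^ 3 + -432 * (n : F) ^ 2 ≠ 0 := by
    intro x hx
    apply hF (x / 6)
    have h6 : (6 : F) ≠ 0 := by norm_num
    field_simp
    linear_combination hx
  have key : ∀ (V : WeierstrassCurve F), V = ⟨0, 0, 0, 0, -432 * (n : F) ^ 2⟩ →
      ∀ Q : V.toAffine.Point, 2 • Q = 0 → Q = 0 := by
    intro V hV
    subst hV
    exact fun Q hQ ↦ JZero.eq_zero_of_two_smul_eq_zero two_ne_zero hb Q hQ
  exact key _ hmap P hP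

end HuShuYin2019

end Literature.NumberTheory.EllipticCurves

end
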